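import Mathlib.Analysis.Normed.Algebra.MatrixExponential
import Mathlib.Analysis.SpecialFunctions.Complex.Log
import Literature.NumberTheory.Automorphic.LieAlgebraGLJordan
import Literature.NumberTheory.Automorphic.LieAlgebraGLNilpotentExp
import Literature.NumberTheory.Automorphic.ChevalleyGroupAdjoint
import Literature.NumberTheory.Automorphic.JordanDecompositionAlgGroup
import Literature.NumberTheory.Automorphic.LieAlgebraGLConjReindex
import Literature.NumberTheory.Automorphic.TorusRigidity
import Literature.NumberTheory.Automorphic.LinearAlgebraicGroupsProofs
import HarnessLib

/-!
# `Lie(G) = {Z | exp(tZ) ∈ G for all t}`: the algebraic Lie algebra of a complex algebraic group is its analytic one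
(trunk T-AUTOMORPHIC vocabulary `lieAlgebraGL`; Goodman–Wallach Theorem 1.4.10)

Namespace `Literature.NumberTheory.Automorphic`, concrete `ℂ`-points vocabulary (`G ≤ GL n ℂ` a subgroup cut out by
polynomial equations, `IsAlgebraicSubgroup`; `lieAlgebraGL G ⊆ 𝔤𝔩ₙ(ℂ)` its Lie algebra AS AN ALGEBRAIC GROUP — the `Z` whose
derivation `D_Z` preserves the ideal `𝓘(G)`, equivalently `p(1 + εZ) = 0` in `ℂ[ε]` for `p ∈ 𝓘(G)`). Written for the lane
`lit-hodgefound` (seat p17, generation 39, row g39-#9a), whose Hodge-group files carry TWO Lie algebras of `Hg(X)(ℂ)`: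
the analytic `hodgeGroupLieC ∕ hodgeGroupComplexLie` (`{Z | e^{tZ} ∈ Hg(X)(ℂ)}`, Hall ∕ Mostow) and the algebraic
`lieAlgebraGL (Hg(X)(ℂ))` (Springer); this file identifies them for every complex algebraic group.

**Theorem (Goodman–Wallach 1.4.10).** For an algebraic subgroup `G ≤ GL(n, ℂ)` with Lie algebra `𝔤` as an algebraic
group, `{A ∈ Mₙ(ℂ) | exp(tA) ∈ G for all t ∈ ℝ} = 𝔤`.

PROOF ROUTE. Goodman–Wallach differentiate `f(exp tA)`; we give the algebraic proof through the Jordan decomposition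
(everything needed is already in the trunk): for `Z = S + N` (Jordan–Chevalley, `[S, N] = 0`) one has
`exp(tZ) = exp(tS) · exp(tN)`, the multiplicative Jordan decomposition of `exp(tZ)`, so for algebraic `G` both factors lie
in `G` (`IsJordanDecomp.mem_of_mem`, Springer 2.4.8); conversely `Z ∈ Lie(G)` has `S, N ∈ Lie(G)` (Springer 4.4.20,
`exists_jordan_mem_lieAlgebraGL`). NILPOTENT PART: `exp(tN) ∈ G` for all `t` iff `N ∈ Lie(G)` (`expHom_mem_of_mem_lieAlgebraGL`,
`mem_lieAlgebraGL_of_expHom_mem`: the curve is polynomial). SEMISIMPLE PART, `S = g⁻¹ diag(s) g`: if `diag(s) ∈ Lie(G')` then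
Chevalley's hull torus `T_s = {diag(d) | d^a = 1 whenever ⟨a, s⟩ = 0}` lies in `G'` (`hullTorus_le_of_diagonal_mem_lieAlgebraGL`,
Borel II.7.3) and contains `diag(e^{ts})` (`∏ e^{t sⱼ aⱼ} = e^{t⟨a, s⟩} = 1`); conversely if `diag(e^{ts}) ∈ G'` for all real
`t`, the subgroup `T` they generate is diagonal and every character `d ↦ d^m` trivial on `T` has `e^{t⟨m, s⟩} = 1` for all
real `t`, whence `⟨m, s⟩ = 0`, so `diag(s) ∈ Lie(T) ⊆ Lie(G')` (`diagonal_mem_lieAlgebraGL_of_forall_diagChar`, Springer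
3.2.10 (4) ∕ 4.4.10 (3)). Real parameters suffice throughout (a polynomial vanishing on `ℝ ⊂ ℂ` vanishes).

## What is proved (theorems only; no definition, no instance, no named fact)

* §1 `coe_expHom_ofAdd_eq_exp` (`expHom N t = exp(tN)` as matrices, `N` nilpotent), `exp_smul_diagonal`
  (private: `e^{tc} = 1` for all real `t` forces `c = 0`; `∏ (e^{z sⱼ})^{aⱼ} = e^{z⟨a, s⟩}`; `g⁻¹ diag(e^{zs}) g = exp(zS)`).
* §2 (⊇) `exists_mem_coe_eq_exp_smul_of_isNilpotent_of_mem_lieAlgebraGL`, `exists_mem_coe_eq_exp_smul_of_isSemisimple_of_mem_lieAlgebraGL`,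
  **`exists_mem_coe_eq_exp_smul_of_mem_lieAlgebraGL`** (`Z ∈ Lie(G) ⟹ exp(zZ) ∈ G` for all complex `z`).
* §3 (⊆) `expHom_mem_of_forall_real_expHom_mem` (real ⟹ complex parameters for the exponential of a nilpotent),
  `mem_lieAlgebraGL_of_isNilpotent_of_forall_real_exp_smul_mem`, `mem_lieAlgebraGL_of_isSemisimple_of_forall_real_exp_smul_mem`
  (no algebraicity needed), **`mem_lieAlgebraGL_of_forall_real_exp_smul_mem`**, `mem_lieAlgebraGL_of_forall_exp_smul_mem`.
* §4 **`mem_lieAlgebraGL_iff_forall_real_exp_smul_mem`** (Goodman–Wallach 1.4.10 verbatim),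
  **`mem_lieAlgebraGL_iff_forall_exp_smul_mem`** (complex one-parameter subgroups), `exists_mem_coe_eq_exp_smul_of_forall_real`
  (a real one-parameter subgroup of an algebraic group is complex).

## References

* [GoodmanWallachGTM255] R. Goodman, N. R. Wallach, *Symmetry, Representations, and Invariants*, GTM 255 (2009), §1.4.4
  Theorem 1.4.10 (and (1.40), (1.41)).
* [SpringerLAG1998] T. A. Springer, *Linear Algebraic Groups*, 2nd ed. (1998), 2.4.8, 3.2.10 (4), 4.4.10 (3), 4.4.15, 4.4.20.
* [Borel1991] A. Borel, *Linear Algebraic Groups*, 2nd ed., GTM 126 (1991), II.7.3.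
-/

noncomputable section

open NormedSpace Matrix

namespace Literature.NumberTheory.Automorphic

variable {n : Type*} [Fintype n] [DecidableEq n] {G : Subgroup (GL n ℂ)}

/-! ## §1 Exponentials of nilpotent and of diagonal matrices -/

/-- `NormedSpace.exp` of a nilpotent complex matrix is the finite exponential sum `IsNilpotent.exp`. [folklore] -/
private theorem exp_eq_isNilpotentExp {N : Matrix n n ℂ} (hN : IsNilpotent N) : exp N = IsNilpotent.exp N := by
  obtain ⟨k, hk⟩ := hN
  rw [NormedSpace.exp_eq_tsum_rat]
  change (∑' m : ℕ, ((m.factorial : ℚ)⁻¹ • N ^ m)) = _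
  rw [tsum_eq_sum (s := Finset.range k), IsNilpotent.exp_eq_sum hk]
  intro m hm
  have hkm : k ≤ m := by simpa using hm
  rw [← Nat.add_sub_of_le hkm, pow_add, hk, zero_mul, smul_zero]

/-- **`expHom N t = exp(tN)`** as matrices, for a nilpotent `N` (the trunk's polynomial exponential `expHom` of
`NilpotentExpRootHom` agrees with the analytic one). [cite: SpringerLAG1998, 4.4.15 (1)] [cite: GoodmanWallachGTM255, §1.4.4 Theorem 1.4.10] -/
theorem coe_expHom_ofAdd_eq_exp {N : Matrix n n ℂ} (hN : IsNilpotent N) (z : ℂ) :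
    ((expHom N hN (Multiplicative.ofAdd z) : GL n ℂ) : Matrix n n ℂ) = exp (z • N) := by
  rw [coe_expHom_apply, toAdd_ofAdd, exp_eq_isNilpotentExp (hN.smul z)]

omit [DecidableEq n] in
/-- `exp(z · diag(s)) = diag(e^{z sᵢ})`. [cite: GoodmanWallachGTM255, §1.4.4 (proof of Theorem 1.4.10)] -/
theorem exp_smul_diagonal [DecidableEq n] (s : n → ℂ) (z : ℂ) :
    exp (z • Matrix.diagonal s) = Matrix.diagonal fun i ↦ Complex.exp (z * s i) := by
  have h : z • Matrix.diagonal s = Matrix.diagonal (fun i ↦ z * s i) := by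
    ext i j
    by_cases hij : i = j
    · subst hij; simp
    · simp [Matrix.diagonal_apply_ne _ hij]
  rw [h, Matrix.exp_diagonal]
  congr 1
  funext i
  rw [Pi.exp_def, congr_fun Complex.exp_eq_exp_ℂ (z * s i)]

omit [Fintype n] in
/-- `diag(d) = exp(z · diag(s))` as matrices when `dᵢ = e^{z sᵢ}`. [folklore] -/
private theorem coe_diagonalGL_eq_exp_smul_diagonal [Fintype n] {s : n → ℂ} {z : ℂ} {d : n → ℂˣ}
    (hd : ∀ i, (d i : ℂ) = Complex.exp (z * s i)) :
    ((diagonalGL n ℂ d : GL n ℂ) : Matrix n n ℂ) = exp (z • Matrix.diagonal s) := by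
  rw [coe_diagonalGL, exp_smul_diagonal]
  exact congrArg Matrix.diagonal (funext hd)

omit [DecidableEq n] in
/-- The character `d ↦ d^a` on `diag(e^{z s})`: `∏ⱼ (e^{z sⱼ})^{aⱼ} = e^{z ⟨a, s⟩}`. [folklore] -/
private theorem coe_prod_zpow_eq_exp_mul_zdot {s : n → ℂ} {z : ℂ} {d : n → ℂˣ}
    (hd : ∀ i, (d i : ℂ) = Complex.exp (z * s i)) (a : n → ℤ) :
    ((∏ j, d j ^ a j : ℂˣ) : ℂ) = Complex.exp (z * zdot a s) := by
  rw [Units.coe_prod, zdot, Finset.mul_sum, Complex.exp_sum]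
  refine Finset.prod_congr rfl fun j _ ↦ ?_
  rw [Units.val_zpow_eq_zpow_val, hd, ← Complex.exp_int_mul]
  ring_nf

/-- **`e^{tc} = 1` for all real `t` forces `c = 0`** (`c ∈ ℂ`): `e^{c} = 1` gives `c = 2πik`, and if `k ≠ 0` then
`t = 1/(2k)` gives `e^{πi} = -1 ≠ 1`. [folklore] -/
private theorem exp_mul_eq_one_forall_real_imp_eq_zero {c : ℂ} (h : ∀ t : ℝ, Complex.exp (t * c) = 1) : c = 0 := by
  by_contra hc
  obtain ⟨k, hk⟩ := Complex.exp_eq_one_iff.1 (by simpa using h 1)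
  have hk0 : (k : ℂ) ≠ 0 := by
    rintro hk0
    rw [hk0, zero_mul] at hk
    exact hc hk
  have h2 := h (1 / (2 * k))
  have hval : ((1 / (2 * k) : ℝ) : ℂ) * c = Real.pi * Complex.I := by
    rw [hk]; push_cast; field_simp
  rw [hval, Complex.exp_pi_mul_I] at h2
  norm_num at h2

/-! ## §2 `Z ∈ Lie(G) ⟹ exp(zZ) ∈ G` -/

/-- **Nilpotent tangent vectors exponentiate into `G`**: `N ∈ Lie(G)` nilpotent ⟹ `exp(zN) ∈ G` for every complex `z`
(the curve `z ↦ exp(zN)` is polynomial and `𝓘(G)` is `D_N`-stable). [cite: SpringerLAG1998, 4.4.15 (1)] [cite: GoodmanWallachGTM255, §1.4.4 Theorem 1.4.10] -/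
theorem exists_mem_coe_eq_exp_smul_of_isNilpotent_of_mem_lieAlgebraGL (hG : IsAlgebraicSubgroup G) {N : Matrix n n ℂ}
    (hN : N ∈ lieAlgebraGL G) (hNn : IsNilpotent N) (z : ℂ) :
    ∃ g ∈ G, ((g : GL n ℂ) : Matrix n n ℂ) = exp (z • N) :=
  ⟨expHom N hNn (Multiplicative.ofAdd z), expHom_mem_of_mem_lieAlgebraGL hG hN hNn _, coe_expHom_ofAdd_eq_exp hNn z⟩

/-- A semisimple matrix is diagonalisable: `g S g⁻¹ = diag(s)` for some `g ∈ GL(n, ℂ)`. [cite: SpringerLAG1998, 2.4.2 (i)] -/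
private theorem exists_conj_eq_diagonal {S : Matrix n n ℂ} (hSs : Module.End.IsSemisimple (Matrix.toLin' S)) :
    ∃ (g : GL n ℂ) (s : n → ℂ), (g : Matrix n n ℂ) * S * ((g⁻¹ : GL n ℂ) : Matrix n n ℂ) = Matrix.diagonal s := by
  have hTc : IsMulCommutative (⊥ : Subgroup (GL n ℂ)) := ⟨⟨fun a b ↦ Subsingleton.elim _ _⟩⟩
  obtain ⟨g, s, -, h⟩ := exists_conj_diagonal_of_isSemisimple (T := ⊥) hTc
    (fun t ht ↦ by rw [Subgroup.mem_bot] at ht; subst ht; exact isSemisimpleElt_of_mem_diagonalSubgroup (Subgroup.one_mem _))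
    hSs (fun t ht ↦ by rw [Subgroup.mem_bot] at ht; subst ht; simp)
  exact ⟨g, s, h⟩

/-- `g⁻¹ diag(e^{zs}) g = exp(zS)` when `g S g⁻¹ = diag(s)`. [folklore] -/
private theorem coe_inv_mul_diagonalGL_mul_eq_exp_smul {S : Matrix n n ℂ} {g : GL n ℂ} {s : n → ℂ}
    (hgS : (g : Matrix n n ℂ) * S * ((g⁻¹ : GL n ℂ) : Matrix n n ℂ) = Matrix.diagonal s) {z : ℂ} {d : n → ℂˣ}
    (hd : ∀ i, (d i : ℂ) = Complex.exp (z * s i)) :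
    ((g⁻¹ * diagonalGL n ℂ d * g : GL n ℂ) : Matrix n n ℂ) = exp (z • S) := by
  have hS : S = ((g⁻¹ : GL n ℂ) : Matrix n n ℂ) * Matrix.diagonal s * (g : Matrix n n ℂ) := by
    rw [← hgS]
    simp only [← Matrix.mul_assoc, Units.inv_mul, Matrix.one_mul]
    rw [Matrix.mul_assoc, Units.inv_mul, Matrix.mul_one]
  rw [Units.val_mul, Units.val_mul, coe_diagonalGL_eq_exp_smul_diagonal hd, ← Matrix.exp_units_conj', hS,
    Matrix.mul_smul, Matrix.smul_mul]

/-- `S = g⁻¹ diag(s) g` when `g S g⁻¹ = diag(s)`. [folklore] -/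
private theorem eq_inv_mul_diagonal_mul {S : Matrix n n ℂ} {g : GL n ℂ} {s : n → ℂ}
    (hgS : (g : Matrix n n ℂ) * S * ((g⁻¹ : GL n ℂ) : Matrix n n ℂ) = Matrix.diagonal s) :
    S = ((g⁻¹ : GL n ℂ) : Matrix n n ℂ) * Matrix.diagonal s * (g : Matrix n n ℂ) := by
  rw [← hgS]
  simp only [← Matrix.mul_assoc, Units.inv_mul, Matrix.one_mul]
  rw [Matrix.mul_assoc, Units.inv_mul, Matrix.mul_one]

/-- **Semisimple tangent vectors exponentiate into `G`** (Chevalley's algebraic hull): `S ∈ Lie(G)` semisimple ⟹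
`exp(zS) ∈ G` for every complex `z` — after diagonalising, the hull torus `T_s ≤ g G g⁻¹` contains `diag(e^{zs})`.
[cite: Borel1991, II.7.3] [cite: GoodmanWallachGTM255, §1.4.4 Theorem 1.4.10] -/
theorem exists_mem_coe_eq_exp_smul_of_isSemisimple_of_mem_lieAlgebraGL (hG : IsAlgebraicSubgroup G) {S : Matrix n n ℂ}
    (hS : S ∈ lieAlgebraGL G) (hSs : Module.End.IsSemisimple (Matrix.toLin' S)) (z : ℂ) :
    ∃ g ∈ G, ((g : GL n ℂ) : Matrix n n ℂ) = exp (z • S) := by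
  obtain ⟨g, s, hgS⟩ := exists_conj_eq_diagonal hSs
  -- `diag(s) ∈ Lie(g G g⁻¹)`, so the hull torus lies in `g G g⁻¹`
  have hdiag : Matrix.diagonal s ∈ lieAlgebraGL (G.map (MulAut.conj g : GL n ℂ →* GL n ℂ)) := by
    rw [← hgS]; exact conj_mem_lieAlgebraGL_map_conj g hS
  have hG' : IsAlgebraicSubgroup (G.map (MulAut.conj g : GL n ℂ →* GL n ℂ)) := by
    have h := hG.map_conj g
    rwa [MulEquiv.toMonoidHom_eq_coe] at h
  set d : n → ℂˣ := fun i ↦ Units.mk0 (Complex.exp (z * s i)) (Complex.exp_ne_zero _) with hd_def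
  have hd : ∀ i, (d i : ℂ) = Complex.exp (z * s i) := fun _ ↦ rfl
  have hmem : diagonalGL n ℂ d ∈ G.map (MulAut.conj g : GL n ℂ →* GL n ℂ) := by
    refine hullTorus_le_of_diagonal_mem_lieAlgebraGL hG' hdiag ((diagonalGL_mem_hullTorus_iff s _).2 fun a ha ↦ ?_)
    apply Units.ext
    rw [coe_prod_zpow_eq_exp_mul_zdot hd, ha, mul_zero, Complex.exp_zero, Units.val_one]
  obtain ⟨x, hx, hxg⟩ := Subgroup.mem_map.1 hmem
  refine ⟨x, hx, ?_⟩
  have hx' : x = g⁻¹ * diagonalGL n ℂ d * g := by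
    rw [← hxg, MonoidHom.coe_coe, MulAut.conj_apply]; group
  rw [hx', coe_inv_mul_diagonalGL_mul_eq_exp_smul hgS hd]

/-- **`Z ∈ Lie(G) ⟹ exp(zZ) ∈ G` for every complex `z`** (`G ≤ GL(n, ℂ)` algebraic): Jordan decomposition `Z = S + N`
inside `Lie(G)` and `exp(zZ) = exp(zS) exp(zN)`. [cite: GoodmanWallachGTM255, §1.4.4 Theorem 1.4.10 ((1.41))]
[cite: SpringerLAG1998, 4.4.20] -/
theorem exists_mem_coe_eq_exp_smul_of_mem_lieAlgebraGL (hG : IsAlgebraicSubgroup G) {Z : Matrix n n ℂ}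
    (hZ : Z ∈ lieAlgebraGL G) (z : ℂ) : ∃ g ∈ G, ((g : GL n ℂ) : Matrix n n ℂ) = exp (z • Z) := by
  obtain ⟨S, N, hS, hN, hSs, hNn, hZSN, hSa, hNa⟩ := exists_jordan_mem_lieAlgebraGL hZ
  have hcomm : Commute S N :=
    Algebra.commute_of_mem_adjoin_singleton_of_commute hNa (Algebra.commute_of_mem_adjoin_self hSa).symm
  obtain ⟨gS, hgS, hgSe⟩ := exists_mem_coe_eq_exp_smul_of_isSemisimple_of_mem_lieAlgebraGL hG hS hSs z
  obtain ⟨gN, hgN, hgNe⟩ := exists_mem_coe_eq_exp_smul_of_isNilpotent_of_mem_lieAlgebraGL hG hN hNn z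
  refine ⟨gS * gN, G.mul_mem hgS hgN, ?_⟩
  rw [Units.val_mul, hgSe, hgNe, hZSN, smul_add, Matrix.exp_add_of_commute _ _ ((hcomm.smul_left z).smul_right z)]

/-! ## §3 `exp(tZ) ∈ G` for all real `t` ⟹ `Z ∈ Lie(G)` -/

/-- **Real parameters suffice for the exponential of a nilpotent**: if `exp(tN) ∈ G` for all real `t` (`G` algebraic)
then `exp(zN) ∈ G` for all complex `z` — each defining polynomial of `G`, composed with the polynomial curve
`z ↦ exp(zN)`, vanishes on `ℝ`, hence identically. [cite: GoodmanWallachGTM255, §1.4.4 Theorem 1.4.10 (proof)] -/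
theorem expHom_mem_of_forall_real_expHom_mem (hG : IsAlgebraicSubgroup G) {N : Matrix n n ℂ} (hNn : IsNilpotent N)
    (h : ∀ t : ℝ, expHom N hNn (Multiplicative.ofAdd (t : ℂ)) ∈ G) (z : ℂ) :
    expHom N hNn (Multiplicative.ofAdd z) ∈ G := by
  obtain ⟨k, hk⟩ := id hNn
  obtain ⟨S, hS⟩ := hG
  rw [← SetLike.mem_coe, hS]
  intro p hp
  have hzero : MvPolynomial.aeval (expCurve N k) p = 0 := by
    refine Polynomial.eq_zero_of_infinite_isRoot _ ?_
    refine Set.infinite_of_injective_forall_mem (f := fun t : ℝ ↦ (t : ℂ)) Complex.ofReal_injective fun t ↦ ?_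
    have ht : expHom N hNn (Multiplicative.ofAdd (t : ℂ)) ∈ zeroLocusGL S := by rw [← hS]; exact h t
    rw [Set.mem_setOf_eq, Polynomial.IsRoot.def, eval_aeval_expCurve hNn hk]
    exact ht p hp
  rw [← eval_aeval_expCurve hNn hk, hzero, Polynomial.eval_zero]

/-- **Nilpotent case of `⊆`**: `N` nilpotent with `exp(tN) ∈ G` for all real `t` (`G` algebraic) ⟹ `N ∈ Lie(G)`
(velocity of a polynomial curve in `G`). [cite: GoodmanWallachGTM255, §1.4.4 Theorem 1.4.10] [cite: SpringerLAG1998, 4.4.15 (1)] -/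
theorem mem_lieAlgebraGL_of_isNilpotent_of_forall_real_exp_smul_mem (hG : IsAlgebraicSubgroup G) {N : Matrix n n ℂ}
    (hNn : IsNilpotent N) (h : ∀ t : ℝ, ∃ g ∈ G, ((g : GL n ℂ) : Matrix n n ℂ) = exp ((t : ℂ) • N)) :
    N ∈ lieAlgebraGL G := by
  have h' : ∀ t : ℝ, expHom N hNn (Multiplicative.ofAdd (t : ℂ)) ∈ G := fun t ↦ by
    obtain ⟨g, hg, hge⟩ := h t
    have : expHom N hNn (Multiplicative.ofAdd (t : ℂ)) = g := Units.ext (by rw [coe_expHom_ofAdd_eq_exp, hge])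
    rw [this]; exact hg
  exact mem_lieAlgebraGL_of_expHom_mem hNn (expHom_mem_of_forall_real_expHom_mem hG hNn h')

/-- **Semisimple case of `⊆`** (no algebraicity needed): `S` semisimple with `exp(tS) ∈ G` for all real `t` ⟹
`S ∈ Lie(G)`. With `g S g⁻¹ = diag(s)`, the diagonal subgroup `T` generated by the `diag(e^{ts}) = g exp(tS) g⁻¹` lies in
`g G g⁻¹`; a character `d ↦ d^m` trivial on `T` has `e^{t⟨m, s⟩} = 1` for all real `t`, so `⟨m, s⟩ = 0`; hence
`diag(s) ∈ Lie(T) ⊆ Lie(g G g⁻¹)`. [cite: SpringerLAG1998, 3.2.10 (4) and 4.4.10 (3)] [cite: GoodmanWallachGTM255, §1.4.4 Theorem 1.4.10] -/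
theorem mem_lieAlgebraGL_of_isSemisimple_of_forall_real_exp_smul_mem {S : Matrix n n ℂ}
    (hSs : Module.End.IsSemisimple (Matrix.toLin' S))
    (h : ∀ t : ℝ, ∃ g ∈ G, ((g : GL n ℂ) : Matrix n n ℂ) = exp ((t : ℂ) • S)) : S ∈ lieAlgebraGL G := by
  obtain ⟨g, s, hgS⟩ := exists_conj_eq_diagonal hSs
  set G' : Subgroup (GL n ℂ) := G.map (MulAut.conj g : GL n ℂ →* GL n ℂ) with hG'
  set d : ℝ → n → ℂˣ := fun t i ↦ Units.mk0 (Complex.exp ((t : ℂ) * s i)) (Complex.exp_ne_zero _) with hd_def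
  have hd : ∀ (t : ℝ) (i : n), (d t i : ℂ) = Complex.exp ((t : ℂ) * s i) := fun _ _ ↦ rfl
  -- the diagonal elements `diag(e^{ts})`, `t` real, lie in `g G g⁻¹`
  have hδ : ∀ t : ℝ, diagonalGL n ℂ (d t) ∈ G' := fun t ↦ by
    obtain ⟨x, hx, hxe⟩ := h t
    refine Subgroup.mem_map.2 ⟨x, hx, ?_⟩
    rw [MonoidHom.coe_coe, MulAut.conj_apply]
    have hx' : x = g⁻¹ * diagonalGL n ℂ (d t) * g :=
      Units.ext (by rw [hxe, coe_inv_mul_diagonalGL_mul_eq_exp_smul hgS (hd t)])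
    rw [hx']; group
  set T : Subgroup (GL n ℂ) := Subgroup.closure (Set.range fun t : ℝ ↦ diagonalGL n ℂ (d t)) with hT
  have hTD : T ≤ diagonalSubgroup n ℂ := (Subgroup.closure_le _).2 (by rintro _ ⟨t, rfl⟩; exact ⟨_, rfl⟩)
  have hTG' : T ≤ G' := (Subgroup.closure_le _).2 (by rintro _ ⟨t, rfl⟩; exact hδ t)
  -- `diag(s) ∈ Lie(T)` from the character relations
  have hdiagT : Matrix.diagonal s ∈ lieAlgebraGL T := by
    refine diagonal_mem_lieAlgebraGL_of_forall_diagChar hTD fun m hm ↦ ?_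
    refine exp_mul_eq_one_forall_real_imp_eq_zero fun t ↦ ?_
    have htT : diagonalGL n ℂ (d t) ∈ T := Subgroup.subset_closure ⟨t, rfl⟩
    have h1 := DFunLike.congr_fun hm ⟨_, htT⟩
    rw [diagChar_apply, MonoidHom.one_apply] at h1
    have hcoord : diagCoord hTD ⟨_, htT⟩ = d t :=
      diagonalGL_injective (by rw [diagonalGL_diagCoord])
    rw [hcoord] at h1
    have h2 := congrArg (fun u : ℂˣ ↦ (u : ℂ)) h1
    simpa only [coe_prod_zpow_eq_exp_mul_zdot (hd t), Units.val_one] using h2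
  -- transport back along `Int(g)`
  have hdiagG' : Matrix.diagonal s ∈ lieAlgebraGL G' := lieAlgebraGL_mono hTG' hdiagT
  rw [eq_inv_mul_diagonal_mul hgS]
  exact (mem_lieAlgebraGL_map_conj_iff_inv_conj_mem G g).1 hdiagG'

/-- Jordan–Chevalley decomposition of a complex matrix: `Z = S + N`, `S` semisimple, `N` nilpotent, `SN = NS`
(Mathlib's `Module.End.exists_isNilpotent_isSemisimple`, transported to matrices). [cite: SpringerLAG1998, 2.4.4] -/
private theorem exists_isSemisimple_add_isNilpotent (Z : Matrix n n ℂ) :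
    ∃ S N : Matrix n n ℂ, Module.End.IsSemisimple (Matrix.toLin' S) ∧ IsNilpotent N ∧ Commute S N ∧ Z = S + N := by
  obtain ⟨n₀, hn₀, s₀, hs₀, hn₀n, hs₀s, hf⟩ := Module.End.exists_isNilpotent_isSemisimple (f := Matrix.toLin' Z)
  let φ : Module.End ℂ (n → ℂ) ≃ₐ[ℂ] Matrix n n ℂ := Matrix.toLinAlgEquiv'.symm
  have hφZ : φ (Matrix.toLin' Z) = Z := LinearMap.toMatrix'_toLin' Z
  refine ⟨φ s₀, φ n₀, ?_, hn₀n.map φ, ?_, ?_⟩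
  · have : Matrix.toLin' (φ s₀) = s₀ := Matrix.toLin'_toMatrix' s₀
    rw [this]; exact hs₀s
  · have hc : Commute s₀ n₀ :=
      Algebra.commute_of_mem_adjoin_singleton_of_commute hn₀ (Algebra.commute_of_mem_adjoin_self hs₀).symm
    change φ s₀ * φ n₀ = φ n₀ * φ s₀
    rw [← map_mul, ← map_mul, hc.eq]
  · rw [← map_add, add_comm, ← hf, hφZ]

/-- **`exp(tZ) ∈ G` for all real `t` ⟹ `Z ∈ Lie(G)`** (`G ≤ GL(n, ℂ)` algebraic): with `Z = S + N` (Jordan–Chevalley),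
`exp(tZ) = (g⁻¹ diag(e^{ts}) g) · exp(tN)` is the multiplicative Jordan decomposition of `exp(tZ) ∈ G`, so both
factors lie in `G` (Springer 2.4.8), and the two cases above apply. [cite: GoodmanWallachGTM255, §1.4.4 Theorem 1.4.10]
[cite: SpringerLAG1998, 2.4.8 and 4.4.20] -/
theorem mem_lieAlgebraGL_of_forall_real_exp_smul_mem (hG : IsAlgebraicSubgroup G) {Z : Matrix n n ℂ}
    (h : ∀ t : ℝ, ∃ g ∈ G, ((g : GL n ℂ) : Matrix n n ℂ) = exp ((t : ℂ) • Z)) : Z ∈ lieAlgebraGL G := by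
  obtain ⟨S, N, hSs, hNn, hcomm, hZ⟩ := exists_isSemisimple_add_isNilpotent Z
  obtain ⟨g, s, hgS⟩ := exists_conj_eq_diagonal hSs
  set d : ℝ → n → ℂˣ := fun t i ↦ Units.mk0 (Complex.exp ((t : ℂ) * s i)) (Complex.exp_ne_zero _) with hd_def
  have hd : ∀ (t : ℝ) (i : n), (d t i : ℂ) = Complex.exp ((t : ℂ) * s i) := fun _ _ ↦ rfl
  -- the Jordan decomposition of `exp(tZ)`
  have hJ : ∀ t : ℝ, (g⁻¹ * diagonalGL n ℂ (d t) * g ∈ G) ∧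
      expHom N hNn (Multiplicative.ofAdd (t : ℂ)) ∈ G := fun t ↦ by
    obtain ⟨x, hx, hxe⟩ := h t
    have hc : Commute ((t : ℂ) • S) ((t : ℂ) • N) := (hcomm.smul_left (t : ℂ)).smul_right (t : ℂ)
    have hSN : exp ((t : ℂ) • S) * exp ((t : ℂ) • N) = exp ((t : ℂ) • Z) := by
      rw [hZ, smul_add, Matrix.exp_add_of_commute _ _ hc]
    have hNS : exp ((t : ℂ) • N) * exp ((t : ℂ) • S) = exp ((t : ℂ) • Z) := by
      rw [hZ, smul_add, add_comm, Matrix.exp_add_of_commute _ _ hc.symm]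
    set sz : GL n ℂ := g⁻¹ * diagonalGL n ℂ (d t) * g with hsz
    set uz : GL n ℂ := expHom N hNn (Multiplicative.ofAdd (t : ℂ)) with huz
    have e1 : (sz : Matrix n n ℂ) = exp ((t : ℂ) • S) := coe_inv_mul_diagonalGL_mul_eq_exp_smul hgS (hd t)
    have e2 : (uz : Matrix n n ℂ) = exp ((t : ℂ) • N) := coe_expHom_ofAdd_eq_exp hNn _
    have hsemi : IsSemisimpleElt sz := by
      simpa only [inv_inv] using (isSemisimpleElt_diagonalGL (d t)).conj g⁻¹
    clear_value sz uz
    have hdec : IsJordanDecomp x sz uz :=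
      { semisimple := hsemi
        unipotent := by
          change IsNilpotent ((uz : Matrix n n ℂ) - 1)
          rw [e2, ← coe_expHom_ofAdd_eq_exp hNn, coe_expHom_apply, toAdd_ofAdd]
          exact IsNilpotent.isNilpotent_exp_sub_one (hNn.smul _)
        mul_eq := Units.ext (by rw [Units.val_mul, e1, e2, hSN, hxe])
        commute := by
          change sz * uz = uz * sz
          exact Units.ext (by rw [Units.val_mul, Units.val_mul, e1, e2, hSN, hNS]) }
    exact hdec.mem_of_mem hG hx
  have hNmem : N ∈ lieAlgebraGL G :=
    mem_lieAlgebraGL_of_expHom_mem hNn (expHom_mem_of_forall_real_expHom_mem hG hNn fun t ↦ (hJ t).2)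
  have hSmem : S ∈ lieAlgebraGL G :=
    mem_lieAlgebraGL_of_isSemisimple_of_forall_real_exp_smul_mem hSs fun t ↦
      ⟨_, (hJ t).1, coe_inv_mul_diagonalGL_mul_eq_exp_smul hgS (hd t)⟩
  rw [hZ]
  exact (lieAlgebraGL G).add_mem hSmem hNmem

/-- Complex parameters: `exp(zZ) ∈ G` for all complex `z` ⟹ `Z ∈ Lie(G)`. [cite: GoodmanWallachGTM255, §1.4.4 Theorem 1.4.10] -/
theorem mem_lieAlgebraGL_of_forall_exp_smul_mem (hG : IsAlgebraicSubgroup G) {Z : Matrix n n ℂ}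
    (h : ∀ z : ℂ, ∃ g ∈ G, ((g : GL n ℂ) : Matrix n n ℂ) = exp (z • Z)) : Z ∈ lieAlgebraGL G :=
  mem_lieAlgebraGL_of_forall_real_exp_smul_mem hG fun t ↦ h t

/-! ## §4 Goodman–Wallach 1.4.10 -/

/-- **Goodman–Wallach, Theorem 1.4.10: for an algebraic subgroup `G ≤ GL(n, ℂ)` with Lie algebra `𝔤 = Lie(G)` as an
algebraic group, `{Z ∈ Mₙ(ℂ) | exp(tZ) ∈ G for all t ∈ ℝ} = 𝔤`.** [cite: GoodmanWallachGTM255, §1.4.4 Theorem 1.4.10] -/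
theorem mem_lieAlgebraGL_iff_forall_real_exp_smul_mem (hG : IsAlgebraicSubgroup G) {Z : Matrix n n ℂ} :
    Z ∈ lieAlgebraGL G ↔ ∀ t : ℝ, ∃ g ∈ G, ((g : GL n ℂ) : Matrix n n ℂ) = exp ((t : ℂ) • Z) :=
  ⟨fun hZ t ↦ exists_mem_coe_eq_exp_smul_of_mem_lieAlgebraGL hG hZ t, mem_lieAlgebraGL_of_forall_real_exp_smul_mem hG⟩

/-- **`Lie(G) = {Z | exp(zZ) ∈ G for all z ∈ ℂ}`** (complex one-parameter subgroups). [cite: GoodmanWallachGTM255, §1.4.4 Theorem 1.4.10 and (1.41)] -/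
theorem mem_lieAlgebraGL_iff_forall_exp_smul_mem (hG : IsAlgebraicSubgroup G) {Z : Matrix n n ℂ} :
    Z ∈ lieAlgebraGL G ↔ ∀ z : ℂ, ∃ g ∈ G, ((g : GL n ℂ) : Matrix n n ℂ) = exp (z • Z) :=
  ⟨exists_mem_coe_eq_exp_smul_of_mem_lieAlgebraGL hG, mem_lieAlgebraGL_of_forall_exp_smul_mem hG⟩

/-- In particular a REAL one-parameter subgroup of an algebraic `G ≤ GL(n, ℂ)` is automatically complex:
`exp(tZ) ∈ G` for all real `t` ⟹ `exp(zZ) ∈ G` for all complex `z`. [cite: GoodmanWallachGTM255, §1.4.4 Theorem 1.4.10] -/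
theorem exists_mem_coe_eq_exp_smul_of_forall_real (hG : IsAlgebraicSubgroup G) {Z : Matrix n n ℂ}
    (h : ∀ t : ℝ, ∃ g ∈ G, ((g : GL n ℂ) : Matrix n n ℂ) = exp ((t : ℂ) • Z)) (z : ℂ) :
    ∃ g ∈ G, ((g : GL n ℂ) : Matrix n n ℂ) = exp (z • Z) :=
  exists_mem_coe_eq_exp_smul_of_mem_lieAlgebraGL hG (mem_lieAlgebraGL_of_forall_real_exp_smul_mem hG h) z

end Literature.NumberTheory.Automorphic

end
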